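import Summits.CriticalPhenomena.CardyFormulaZ2.Theorems.CardyAnchoredRigidityClusterSetConnectedStubWalkExtraction
import Summits.CriticalPhenomena.CardyFormulaZ2.Theorems.CardyAnchoredRigidityClusterSetConnectedStubSandwichLowerOfWalks
import Summits.CriticalPhenomena.CardyFormulaZ2.Theorems.CardyAnchoredRigidityClusterSetConnectedStubSandwichUpper
import Summits.CriticalPhenomena.CardyFormulaZ2.Theorems.CardyAnchoredRigidityClusterSetConnectedStubPerturbationContinuity
import Summits.CriticalPhenomena.CardyFormulaZ2.Theorems.CardyAnchoredRigidityClusterSetConnectedStubClusterSetPreconnected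
import Summits.CriticalPhenomena.CardyFormulaZ2.Theses.CardyAnchoredRigidity
import Summits.CriticalPhenomena.CardyFormulaZ2.Theses.CardyLocalRigidity
import HarnessLib

/-!
# Crux `ClusterSetConnected` (stmt-CriticalPhenomena-5769) — the cluster set of the bond-`ℤ²`
# crossing-function path is preconnected

Routes `route-CriticalPhenomena-CardyAnchoredRigidity` and `route-CriticalPhenomena-CardyLocalRigidity`
(the crux is ONE shared item rendered in both route files; the two declarations are the same term),
sub-problem `CardyFormulaZ2`. Statement:

  `IsPreconnected {g : ConformalRectangle → ℝ | MapClusterPt g (𝓝[>] 0) (fun δ R => bondDomainCrossingProb R δ)}`.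

This is the sorry-free form of the registered skeleton `Cruxes/ClusterSetConnected/Lines/registered.lean`
(line `registered`), assembled from its landed stubs:

* S1a-W `stub_walkExtraction` — a compact connected set inside the drawn open edges of `δℤ²` is
  shadowed by an open lattice chain;
* S1a `stub_sandwichLowerOfWalks` — for a square model `Φ` of `R`, the continuum crossing event of
  the tall-narrow perturbation `Φ([-1+s,1-s] × [-1-s,1+s])` forces G02's discrete crossing event
  `discreteCrossing R.carrier δ (R.arc 0) (R.arc 2)` at small mesh;
* S1b `stub_sandwichUpper` — the discrete crossing event forces the continuum crossing event of the
  wide-short perturbation `Φ([-1-s,1+s] × [-1+s,1-s])` at small mesh;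
* S1c `stub_perturbationContinuity` — Schramm–Smirnov's discrete continuity estimate (5.1)
  (PROVED in the tree for bond-`ℤ²`: `QuadCrossing.SchrammSmirnov2011_lemma_5_1_holds`,
  `QuadCrossing.Quad.continuity_uniform_pair`) combined with the exact dilation covariance of the
  raw crossing events: the wide-short event at one mesh exceeds the tall-narrow event at a
  `(1+θ)`-comparable mesh by `< ε` in probability;
* S2 `stub_clusterSetPreconnected` — the cluster set at `0⁺` of a precompact path in a product of
  lines whose every coordinate is asymptotically continuous in `log δ` is preconnected.

`scaleContinuity` (= the support item `ScaleContinuity`, stmt-CriticalPhenomena-5770, proved on the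
way): S1a + S1b sandwich `p_R(δ) = P[discreteCrossing]` between the two perturbation events at each
mesh, S1c bounds the cross differences. `clusterSetConnected` : S2 at `ι := ConformalRectangle`,
`K := [0,1]^ConformalRectangle`, fed by `scaleContinuity`. No named fact is used: the trust base is
the kernel.
-/

noncomputable section

open Filter Topology Set MeasureTheory
open Literature.Probability.RandomPlanarGeometry Literature.Probability.Percolation
open Literature.Probability.LatticeModels

namespace Summit.CriticalPhenomena.CardyFormulaZ2.Theorems.ClusterSetConnected

/-- **Scale continuity of every crossing probability** (support item `ScaleContinuity`,
stmt-CriticalPhenomena-5770): for every conformal rectangle `R` and `ε > 0` there are `θ > 0`,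
`δ₀ > 0` with `|p_R(δ') - p_R(δ)| < ε` whenever `0 < δ ≤ δ' < δ₀`, `δ' ≤ (1+θ)δ`. From the sandwich
S1a/S1b at a square model of `R` and the Schramm–Smirnov estimate S1c. -/
theorem scaleContinuity :
    Summit.CriticalPhenomena.CardyFormulaZ2.Theses.CardyLocalRigidity.ScaleContinuity := by
  intro R ε hε
  obtain ⟨Φ, hΦ⟩ := exists_isSquareModel R
  obtain ⟨s, hxT, hyT, hxW, hyW, hs, θ, hθ, δ₁, hδ₁, H⟩ := stub_perturbationContinuity Φ ε hε
  obtain ⟨δa, hδa, Ha⟩ := stub_sandwichLowerOfWalks stub_walkExtraction R Φ hΦ s hxT hyT hs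
  obtain ⟨δb, hδb, Hb⟩ := stub_sandwichUpper R Φ hΦ s hxW hyW hs
  refine ⟨θ, hθ, min δ₁ (min δa δb), lt_min hδ₁ (lt_min hδa hδb), ?_⟩
  intro δ δ' hδ hδδ' hδ'lt hratio
  have hδ' : 0 < δ' := hδ.trans_le hδδ'
  have hδ'₁ : δ' < δ₁ := hδ'lt.trans_le (min_le_left _ _)
  have hδ'a : δ' < δa := hδ'lt.trans_le ((min_le_right _ _).trans (min_le_left _ _))
  have hδ'b : δ' < δb := hδ'lt.trans_le ((min_le_right _ _).trans (min_le_right _ _))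
  have hδa' : δ < δa := hδδ'.trans_lt hδ'a
  have hδb' : δ < δb := hδδ'.trans_lt hδ'b
  obtain ⟨H1, H2⟩ := H δ δ' hδ hδδ' hδ'₁ hratio
  rw [bondDomainCrossingProb_eq_measureReal, bondDomainCrossingProb_eq_measureReal]
  have hup' := measureReal_mono (μ := bondPercolation (zdGraph 2) half) (Hb δ' hδ' hδ'b)
  have hup := measureReal_mono (μ := bondPercolation (zdGraph 2) half) (Hb δ hδ hδb')
  have hlow' := measureReal_mono (μ := bondPercolation (zdGraph 2) half) (Ha δ' hδ' hδ'a)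
  have hlow := measureReal_mono (μ := bondPercolation (zdGraph 2) half) (Ha δ hδ hδa')
  rw [abs_sub_lt_iff]
  constructor <;> linarith

/-- **The crux `ClusterSetConnected`** under the item's default declaration name
`…Theses.CardyLocalRigidity.ClusterSetConnected`: the cluster set, as `δ → 0⁺`, of the
crossing-function path `δ ↦ (R ↦ bondDomainCrossingProb R δ)` is preconnected in the product space
`ConformalRectangle → ℝ`. S2 at the compact box `[0,1]^ConformalRectangle` (Tychonoff,
`bondDomainCrossingProb_mem_Icc`), fed coordinatewise by `scaleContinuity`. -/
theorem clusterSetConnected :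
    Summit.CriticalPhenomena.CardyFormulaZ2.Theses.CardyLocalRigidity.ClusterSetConnected := by
  have hK : IsCompact (Set.pi Set.univ (fun _ : ConformalRectangle => Set.Icc (0 : ℝ) 1)) :=
    isCompact_univ_pi fun _ => isCompact_Icc
  have hPK : ∀ δ : ℝ, 0 < δ →
      (fun R : ConformalRectangle => bondDomainCrossingProb R δ) ∈
        Set.pi Set.univ (fun _ : ConformalRectangle => Set.Icc (0 : ℝ) 1) :=
    fun δ _ => Set.mem_univ_pi.2 fun R => bondDomainCrossingProb_mem_Icc R δ
  exact stub_clusterSetPreconnected ConformalRectangle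
    (fun (δ : ℝ) (R : ConformalRectangle) => bondDomainCrossingProb R δ)
    (Set.pi Set.univ (fun _ : ConformalRectangle => Set.Icc (0 : ℝ) 1)) hK hPK
    (fun R ε hε => scaleContinuity R ε hε)

/-- **The crux `ClusterSetConnected`** under this route's declaration name
`…Theses.CardyAnchoredRigidity.ClusterSetConnected` (definitionally the `CardyLocalRigidity` one:
the crux is one shared item rendered in two route files). -/
theorem clusterSetConnected_anchored :
    Summit.CriticalPhenomena.CardyFormulaZ2.Theses.CardyAnchoredRigidity.ClusterSetConnected :=
  clusterSetConnected

end Summit.CriticalPhenomena.CardyFormulaZ2.Theorems.ClusterSetConnected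

end
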